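import Mathlib.Algebra.Homology.Embedding.Extend
import Mathlib.CategoryTheory.Preadditive.AdditiveFunctor
import Literature.Algebra.Homology.StaircaseComplexes
import Literature.Algebra.Homology.StaircaseTorsionFree
import Literature.Algebra.Homology.StaircaseBounds
import HarnessLib

/-!
# A staircase image subcomplex is a retract of the complex up to a power of `q`

Continuation of `Algebra/Homology/StaircaseComplexes`: `K` is an `ℕ`-indexed cochain complex in an
abelian category, `q : ℤ`, `e` an antitone exponent function, `powImage K q he = (q^{e j} Kʲ)ⱼ` the
staircase image subcomplex and `ι = powImageι K q he : q^{e} K ⟶ K` its inclusion (degreewise the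
image inclusion of multiplication by `q ^ e j`). The inclusion is INVERTIBLE UP TO THE CONSTANT
`q ^ e 0`: we construct the chain map

* `ψ = powImageRetraction K q he : K ⟶ powImage K q he` — in degree `j`, multiplication by
  `q ^ (e 0 - e j)` followed by the corestriction `Kʲ ↠ q^{e j} Kʲ` of multiplication by `q ^ e j`,

and prove `ψ ≫ ι = q^{e 0} • 𝟙 K` (`powImageRetraction_comp_powImageι`), `ι ≫ ψ = q^{e 0} • 𝟙`
(`powImageι_comp_powImageRetraction`), their degreewise forms, and the same identities after
extension by zero to `ℤ`-indexed complexes along `ComplexShape.embeddingUpNat` (the form consumed by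
hyper-Ext / hypercohomology). Consequences for the terms: if `Kʲ` has no `q`-torsion (`q • 𝟙 Kʲ`
mono) then `(q^{e} K)ʲ ≅ Kʲ` (`powImageXIso`: the image of the MONOMORPHISM `q ^ e j`), under which
`ιʲ` is multiplication by `q ^ e j`, `ψʲ` is multiplication by `q ^ (e 0 - e j)` and the
differential `q^{e j} Kʲ → q^{e (j+1)} Kʲ⁺¹` is `q ^ (e j - e (j+1)) • d`
(`powImageXIso_inv_d_hom`); past the staircase (`e j = 0`) `ιʲ` is an isomorphism for every `K`
(`isIso_powImageι_f`).

The staircase of interest is `e j = r - j` (antitone: Mathlib's `antitone_const_tsub`), `e 0 = r`,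
respecialised in the last section (`…_of_sub`, `…_of_le`, `…_of_lt`): for the de Rham complex
`K = Ω•` of a smooth `p`-adic formal lift `X•`, `powImage K p (r - ·)` is Bloch–Esnault–Kerz's
`p(r)Ω•_{X•} = [pʳ𝒪 → pʳ⁻¹Ω¹ → ⋯ → pΩʳ⁻¹ → Ωʳ → Ωʳ⁺¹ → ⋯]`
[cite: BlochEsnaultKerz2014pAdic, §2 Def. 2.8], recalled as Def. 8.1 of X. Hu, arXiv:2507.12458,
whose finite-level complexes `p^{r,L}Ω•`, `p(r)Ω•_{X_n} = p^{r,1}_{r,n}Ω•` (Def. 8.2) are the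
staircases `e j = (r - j) L` inside staircase quotients — covered by the general `e` here, with
`q ^ e 0 = p^{rL}`. Since `ι ψ = ψ ι = pʳ`, every additive functor (hyper-Ext, hypercohomology, the
Hodge–de Rham spectral sequence) takes `ι` to a morphism invertible up to `pʳ`, hence invertible
RATIONALLY: the rational `E₁`-degeneration for `Ω•_{𝒳/W}` transfers verbatim to `p(r)Ω•_𝒳`, the
complex that (unlike `Ω•_𝒳`) reduces termwise onto Hu's finite-level `p(r)Ω•_{X_n}`. [folklore]

Everything is proved; no named facts. NOT here: the hyper-Ext / hypercohomology statements
(`Algebra/Homology/HyperExt`), the quotients `K / p(r)K` and Hu's three-term sequences, anything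
specific to de Rham complexes.
-/

noncomputable section

namespace Literature.Algebra.Homology

open CategoryTheory CategoryTheory.Limits

universe v u

variable {𝒜 : Type u} [Category.{v} 𝒜] [Abelian 𝒜]

/-! ### The retraction `ψ : K ⟶ q^{e} K` -/

section Retraction

variable (K : CochainComplex 𝒜 ℕ) (q : ℤ) {e : ℕ → ℕ} (he : Antitone e)

include he in
/-- The degree-`j` component of the retraction, unpackaged: multiplication by `q ^ (e 0 - e j)`
followed by the corestriction `Kʲ ↠ q^{e j} Kʲ` of `q ^ e j` and the inclusion `q^{e j} Kʲ ↪ Kʲ` is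
multiplication by `q ^ e 0` (as `e j ≤ e 0`). [folklore] -/
@[reassoc]
theorem zsmul_factorThruImage_powSMul_ι (j : ℕ) :
    ((q ^ (e 0 - e j) : ℤ) • factorThruImage (powSMul K q e j)) ≫ image.ι (powSMul K q e j) =
      (q ^ e 0 : ℤ) • 𝟙 (K.X j) := by
  rw [Preadditive.zsmul_comp, image.fac, smul_smul, ← pow_add,
    Nat.sub_add_cancel (he (Nat.zero_le j))]

/-- **The retraction `ψ : K ⟶ q^{e} K` onto a staircase image subcomplex**: in degree `j`,
multiplication by `q ^ (e 0 - e j)` followed by the corestriction `Kʲ ↠ q^{e j} Kʲ` of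
multiplication by `q ^ e j`, so that `ψʲ` followed by the inclusion is multiplication by the
constant `q ^ e 0` (which makes `ψ` a chain map). For BEK's staircase `e j = r - j` on a de Rham
complex: `ω ↦ pʳω ∈ p^{r-j}Ωʲ`. [folklore] -/
def powImageRetraction : K ⟶ powImage K q he where
  f j := (q ^ (e 0 - e j) : ℤ) • factorThruImage (powSMul K q e j)
  comm' i j hij := by
    change i + 1 = j at hij
    subst hij
    rw [← cancel_mono (image.ι (powSMul K q e (i + 1))), Category.assoc, Category.assoc, powImage_d,
      powImageD_ι, zsmul_factorThruImage_powSMul_ι_assoc K q he i,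
      zsmul_factorThruImage_powSMul_ι K q he (i + 1), pow_smul_id_comp]

/-- The components of the retraction. [folklore] -/
theorem powImageRetraction_f (j : ℕ) :
    (powImageRetraction K q he).f j = (q ^ (e 0 - e j) : ℤ) • factorThruImage (powSMul K q e j) :=
  rfl

/-- `ψʲ ≫ (q^{e j} Kʲ ↪ Kʲ) = q ^ e 0 • 𝟙` degreewise (image-inclusion form). [folklore] -/
@[reassoc (attr := simp)]
theorem powImageRetraction_f_ι (j : ℕ) :
    (powImageRetraction K q he).f j ≫ image.ι (powSMul K q e j) = (q ^ e 0 : ℤ) • 𝟙 (K.X j) :=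
  zsmul_factorThruImage_powSMul_ι K q he j

/-- `ψʲ ≫ ιʲ = q ^ e 0 • 𝟙` degreewise. [folklore] -/
@[reassoc]
theorem powImageRetraction_f_powImageι_f (j : ℕ) :
    (powImageRetraction K q he).f j ≫ (powImageι K q he).f j = (q ^ e 0 : ℤ) • 𝟙 (K.X j) :=
  zsmul_factorThruImage_powSMul_ι K q he j

/-- **`ψ ≫ ι = q ^ e 0 • 𝟙 K`**: the retraction followed by the inclusion `q^{e} K ↪ K` is
multiplication by `q ^ e 0`. [folklore] -/
@[reassoc (attr := simp)]
theorem powImageRetraction_comp_powImageι :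
    powImageRetraction K q he ≫ powImageι K q he = (q ^ e 0 : ℤ) • 𝟙 K :=
  HomologicalComplex.hom_ext _ _ fun j ↦ by
    rw [HomologicalComplex.comp_f, HomologicalComplex.zsmul_f_apply, HomologicalComplex.id_f,
      powImageι_f, powImageRetraction_f_ι]

/-- `(q^{e j} Kʲ ↪ Kʲ) ≫ ψʲ = q ^ e 0 • 𝟙` degreewise (image-inclusion form). [folklore] -/
@[reassoc (attr := simp)]
theorem ι_powImageRetraction_f (j : ℕ) :
    image.ι (powSMul K q e j) ≫ (powImageRetraction K q he).f j =
      (q ^ e 0 : ℤ) • 𝟙 ((powImage K q he).X j) := by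
  rw [← cancel_mono (image.ι (powSMul K q e j)), Category.assoc, powImageRetraction_f_ι]
  exact (pow_smul_id_comp q (image.ι (powSMul K q e j)) (e 0)).symm

/-- `ιʲ ≫ ψʲ = q ^ e 0 • 𝟙` degreewise. [folklore] -/
@[reassoc]
theorem powImageι_f_powImageRetraction_f (j : ℕ) :
    (powImageι K q he).f j ≫ (powImageRetraction K q he).f j =
      (q ^ e 0 : ℤ) • 𝟙 ((powImage K q he).X j) :=
  ι_powImageRetraction_f K q he j

/-- **`ι ≫ ψ = q ^ e 0 • 𝟙 (q^{e} K)`**: the inclusion followed by the retraction is multiplication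
by `q ^ e 0`. [folklore] -/
@[reassoc (attr := simp)]
theorem powImageι_comp_powImageRetraction :
    powImageι K q he ≫ powImageRetraction K q he = (q ^ e 0 : ℤ) • 𝟙 (powImage K q he) :=
  HomologicalComplex.hom_ext _ _ fun j ↦ by
    rw [HomologicalComplex.comp_f, HomologicalComplex.zsmul_f_apply, HomologicalComplex.id_f,
      powImageι_f, ι_powImageRetraction_f]

/-! ### After extension by zero to `ℤ`-indexed complexes -/

/-- `ψ ≫ ι = q ^ e 0 • 𝟙` after extension by zero to `ℤ`-indexed cochain complexes (Mathlib's
additive functor `ComplexShape.embeddingUpNat.extendFunctor`). [folklore] -/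
@[reassoc]
theorem extendFunctor_map_powImageRetraction_comp_map_powImageι :
    (ComplexShape.embeddingUpNat.extendFunctor 𝒜).map (powImageRetraction K q he) ≫
        (ComplexShape.embeddingUpNat.extendFunctor 𝒜).map (powImageι K q he) =
      (q ^ e 0 : ℤ) • 𝟙 ((ComplexShape.embeddingUpNat.extendFunctor 𝒜).obj K) := by
  rw [← Functor.map_comp, powImageRetraction_comp_powImageι, Functor.map_zsmul,
    CategoryTheory.Functor.map_id]

/-- `ι ≫ ψ = q ^ e 0 • 𝟙` after extension by zero to `ℤ`-indexed cochain complexes. [folklore] -/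
@[reassoc]
theorem extendFunctor_map_powImageι_comp_map_powImageRetraction :
    (ComplexShape.embeddingUpNat.extendFunctor 𝒜).map (powImageι K q he) ≫
        (ComplexShape.embeddingUpNat.extendFunctor 𝒜).map (powImageRetraction K q he) =
      (q ^ e 0 : ℤ) • 𝟙 ((ComplexShape.embeddingUpNat.extendFunctor 𝒜).obj (powImage K q he)) := by
  rw [← Functor.map_comp, powImageι_comp_powImageRetraction, Functor.map_zsmul,
    CategoryTheory.Functor.map_id]

/-- `ψ ≫ ι = q ^ e 0 • 𝟙` after extension by zero (`HomologicalComplex.extendMap` form).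
[folklore] -/
@[reassoc]
theorem extendMap_powImageRetraction_comp_extendMap_powImageι :
    HomologicalComplex.extendMap (powImageRetraction K q he) ComplexShape.embeddingUpNat ≫
        HomologicalComplex.extendMap (powImageι K q he) ComplexShape.embeddingUpNat =
      (q ^ e 0 : ℤ) • 𝟙 (K.extend ComplexShape.embeddingUpNat) :=
  extendFunctor_map_powImageRetraction_comp_map_powImageι K q he

/-- `ι ≫ ψ = q ^ e 0 • 𝟙` after extension by zero (`HomologicalComplex.extendMap` form).
[folklore] -/
@[reassoc]
theorem extendMap_powImageι_comp_extendMap_powImageRetraction :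
    HomologicalComplex.extendMap (powImageι K q he) ComplexShape.embeddingUpNat ≫
        HomologicalComplex.extendMap (powImageRetraction K q he) ComplexShape.embeddingUpNat =
      (q ^ e 0 : ℤ) • 𝟙 ((powImage K q he).extend ComplexShape.embeddingUpNat) :=
  extendFunctor_map_powImageι_comp_map_powImageRetraction K q he

end Retraction

/-! ### Consequences for the terms -/

section Terms

variable (K : CochainComplex 𝒜 ℕ) (q : ℤ) {e : ℕ → ℕ} (he : Antitone e)

/-- If `Kʲ` has no `q`-torsion (`q • 𝟙 Kʲ` mono) then multiplication by `q ^ e j` on `Kʲ` is a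
monomorphism. [folklore] -/
theorem mono_powSMul (e : ℕ → ℕ) (j : ℕ) [Mono ((q : ℤ) • 𝟙 (K.X j))] : Mono (powSMul K q e j) :=
  mono_pow_smul_id q (e j)

/-- **`(q^{e} K)ʲ ≅ Kʲ` when `Kʲ` has no `q`-torsion**: the image of the monomorphism `q ^ e j` is
its source (e.g. `p^{r-j}Ωʲ ≅ Ωʲ` for the `p`-torsion-free de Rham sheaves of a smooth formal lift).
[folklore] -/
def powImageXIso (j : ℕ) [Mono ((q : ℤ) • 𝟙 (K.X j))] : (powImage K q he).X j ≅ K.X j :=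
  haveI := mono_powSMul K q e j
  imageMonoIsoSource (powSMul K q e j)

/-- Under `(q^{e} K)ʲ ≅ Kʲ` the inclusion becomes multiplication by `q ^ e j`:
`iso.hom ≫ q^{e j} = (q^{e j} Kʲ ↪ Kʲ)`. [folklore] -/
@[reassoc (attr := simp)]
theorem powImageXIso_hom_powSMul (j : ℕ) [Mono ((q : ℤ) • 𝟙 (K.X j))] :
    (powImageXIso K q he j).hom ≫ powSMul K q e j = image.ι (powSMul K q e j) :=
  haveI := mono_powSMul K q e j
  imageMonoIsoSource_hom_self _

/-- `iso.inv ≫ (q^{e j} Kʲ ↪ Kʲ) = q ^ e j`. [folklore] -/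
@[reassoc (attr := simp)]
theorem powImageXIso_inv_ι (j : ℕ) [Mono ((q : ℤ) • 𝟙 (K.X j))] :
    (powImageXIso K q he j).inv ≫ image.ι (powSMul K q e j) = powSMul K q e j :=
  haveI := mono_powSMul K q e j
  imageMonoIsoSource_inv_ι _

/-- Under `(q^{e} K)ʲ ≅ Kʲ` the retraction `ψʲ` becomes multiplication by `q ^ (e 0 - e j)`.
[folklore] -/
@[reassoc (attr := simp)]
theorem powImageRetraction_f_powImageXIso_hom (j : ℕ) [Mono ((q : ℤ) • 𝟙 (K.X j))] :
    (powImageRetraction K q he).f j ≫ (powImageXIso K q he j).hom =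
      (q ^ (e 0 - e j) : ℤ) • 𝟙 (K.X j) := by
  haveI := mono_powSMul K q e j
  rw [← cancel_mono (powSMul K q e j), Category.assoc, powImageXIso_hom_powSMul,
    powImageRetraction_f_ι, pow_smul_id_comp_pow_smul_id, Nat.sub_add_cancel (he (Nat.zero_le j))]

/-- Under the identifications `(q^{e} K)ʲ ≅ Kʲ`, `(q^{e} K)ʲ⁺¹ ≅ Kʲ⁺¹` (no `q`-torsion in
degrees `j`, `j + 1`) the differential of `q^{e} K` becomes `q ^ (e j - e (j+1)) • d` (for BEK's
staircase: `p • d` below degree `r`, `d` from degree `r` on). [folklore] -/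
@[reassoc]
theorem powImageXIso_inv_d_hom (j : ℕ) [Mono ((q : ℤ) • 𝟙 (K.X j))]
    [Mono ((q : ℤ) • 𝟙 (K.X (j + 1)))] :
    (powImageXIso K q he j).inv ≫ (powImage K q he).d j (j + 1) ≫
        (powImageXIso K q he (j + 1)).hom = (q ^ (e j - e (j + 1)) : ℤ) • K.d j (j + 1) := by
  haveI := mono_powSMul K q e (j + 1)
  rw [← cancel_mono (powSMul K q e (j + 1)), Category.assoc, Category.assoc,
    powImageXIso_hom_powSMul, powImage_d, powImageD_ι, powImageXIso_inv_ι_assoc,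
    powSMul_comp_d K q he j]

/-- If multiplication by `q ^ e j` on `Kʲ` is an epimorphism (e.g. `e j = 0`, or `q` invertible on
`Kʲ`) then the inclusion `q^{e j} Kʲ ↪ Kʲ` is an isomorphism (abelian categories are balanced).
[folklore] -/
theorem isIso_ι_powSMul (e : ℕ → ℕ) (j : ℕ) [Epi (powSMul K q e j)] :
    IsIso (image.ι (powSMul K q e j)) :=
  haveI := epi_image_of_epi (powSMul K q e j)
  isIso_of_mono_of_epi _

/-- **Past the staircase the inclusion is an isomorphism**: if `e j = 0` then `ιʲ : q⁰ Kʲ ↪ Kʲ`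
is an isomorphism, for every `K` (BEK's `p(r)Ωʲ = Ωʲ` for `j ≥ r`). [folklore] -/
theorem isIso_powImageι_f {j : ℕ} (hj : e j = 0) : IsIso ((powImageι K q he).f j) := by
  haveI : Epi (powSMul K q e j) := by rw [powSMul_eq_id K q hj]; infer_instance
  rw [powImageι_f]
  exact isIso_ι_powSMul K q e j

end Terms

/-! ### The Bloch–Esnault–Kerz staircase `e j = r - j` -/

section BEK

variable (K : CochainComplex 𝒜 ℕ) (q : ℤ) {r : ℕ} (he : Antitone fun j : ℕ ↦ r - j)

/-- BEK staircase: `ψ ≫ ι = qʳ • 𝟙 K` (`p(r)Ω• ↪ Ω•` is invertible up to `pʳ`). [folklore] -/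
@[reassoc]
theorem powImageRetraction_comp_powImageι_of_sub :
    powImageRetraction K q he ≫ powImageι K q he = (q ^ r : ℤ) • 𝟙 K :=
  powImageRetraction_comp_powImageι K q he

/-- BEK staircase: `ι ≫ ψ = qʳ • 𝟙 (p(r)K)`. [folklore] -/
@[reassoc]
theorem powImageι_comp_powImageRetraction_of_sub :
    powImageι K q he ≫ powImageRetraction K q he = (q ^ r : ℤ) • 𝟙 (powImage K q he) :=
  powImageι_comp_powImageRetraction K q he

/-- BEK staircase, after extension by zero to `ℤ`: `ψ ≫ ι = qʳ • 𝟙`. [folklore] -/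
@[reassoc]
theorem extendFunctor_map_powImageRetraction_comp_map_powImageι_of_sub :
    (ComplexShape.embeddingUpNat.extendFunctor 𝒜).map (powImageRetraction K q he) ≫
        (ComplexShape.embeddingUpNat.extendFunctor 𝒜).map (powImageι K q he) =
      (q ^ r : ℤ) • 𝟙 ((ComplexShape.embeddingUpNat.extendFunctor 𝒜).obj K) :=
  extendFunctor_map_powImageRetraction_comp_map_powImageι K q he

/-- BEK staircase, after extension by zero to `ℤ`: `ι ≫ ψ = qʳ • 𝟙`. [folklore] -/
@[reassoc]
theorem extendFunctor_map_powImageι_comp_map_powImageRetraction_of_sub :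
    (ComplexShape.embeddingUpNat.extendFunctor 𝒜).map (powImageι K q he) ≫
        (ComplexShape.embeddingUpNat.extendFunctor 𝒜).map (powImageRetraction K q he) =
      (q ^ r : ℤ) • 𝟙 ((ComplexShape.embeddingUpNat.extendFunctor 𝒜).obj (powImage K q he)) :=
  extendFunctor_map_powImageι_comp_map_powImageRetraction K q he

/-- BEK staircase, terms: under `p^{r-j}Kʲ ≅ Kʲ` (`Kʲ` without `q`-torsion, `j ≤ r`) the retraction
`ψʲ` is multiplication by `q ^ j`. [folklore] -/
@[reassoc]
theorem powImageRetraction_f_powImageXIso_hom_of_le {j : ℕ} (hj : j ≤ r)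
    [Mono ((q : ℤ) • 𝟙 (K.X j))] :
    (powImageRetraction K q he).f j ≫ (powImageXIso K q he j).hom = (q ^ j : ℤ) • 𝟙 (K.X j) := by
  rw [powImageRetraction_f_powImageXIso_hom, Nat.sub_zero, Nat.sub_sub_self hj]

/-- BEK staircase, terms: below degree `r` the differential `p^{r-j}Kʲ → p^{r-j-1}Kʲ⁺¹` is `q • d`
under the identifications with `Kʲ`, `Kʲ⁺¹` (no `q`-torsion). [folklore] -/
@[reassoc]
theorem powImageXIso_inv_d_hom_of_lt {j : ℕ} (hj : j < r) [Mono ((q : ℤ) • 𝟙 (K.X j))]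
    [Mono ((q : ℤ) • 𝟙 (K.X (j + 1)))] :
    (powImageXIso K q he j).inv ≫ (powImage K q he).d j (j + 1) ≫
        (powImageXIso K q he (j + 1)).hom = (q : ℤ) • K.d j (j + 1) := by
  rw [powImageXIso_inv_d_hom, show r - j - (r - (j + 1)) = 1 by omega, pow_one]

/-- BEK staircase, terms: from degree `r` on the differential of `p(r)K` is `d` under the
identifications with `Kʲ`, `Kʲ⁺¹` (no `q`-torsion). [folklore] -/
@[reassoc]
theorem powImageXIso_inv_d_hom_of_le {j : ℕ} (hj : r ≤ j) [Mono ((q : ℤ) • 𝟙 (K.X j))]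
    [Mono ((q : ℤ) • 𝟙 (K.X (j + 1)))] :
    (powImageXIso K q he j).inv ≫ (powImage K q he).d j (j + 1) ≫
        (powImageXIso K q he (j + 1)).hom = K.d j (j + 1) := by
  rw [powImageXIso_inv_d_hom, show r - j - (r - (j + 1)) = 0 by omega, pow_zero, one_smul]

/-- BEK staircase: in degrees `j ≥ r` the inclusion `p(r)Kʲ ↪ Kʲ` is an isomorphism, for every `K`.
[folklore] -/
theorem isIso_powImageι_f_of_le {j : ℕ} (hj : r ≤ j) : IsIso ((powImageι K q he).f j) :=
  isIso_powImageι_f K q he (Nat.sub_eq_zero_of_le hj)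

end BEK

end Literature.Algebra.Homology

end
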